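import Literature.Computability.Complexity.CliqueVerifierBricks
import HarnessLib

/-!
# Route NegLimited — the `⌊m^{1/4}⌋`-clique certificate verifier (door stub 4, part a; rung F-N1/p3)

For the door support `QuartCliqueSlicesNP` (line `correlation-door` on stmt-PneNP-19860, registered
stub `stub_quartCliqueSlicesNP`): the clique-certificate verifier of
`Literature/Computability/Complexity/CliqueVerifierBricks.lean` (`CliqueVerifier.verFn`, clique size
`⌊√m⌋`) with the clique size replaced by `⌊√⌊√m⌋⌋` (= `⌊m^{1/4}⌋` up to rounding, the size of the door
items).  Only the count test changes: `vK4 = 1^{⌊√⌊√m⌋⌋}` is obtained from the PUBLIC pieces `vM`, `vK`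
of the bricks file by one more `isqrtFn`; the edge test `edgesOK` is reused as is.

* `Quart.vK4`, `Quart.cntOK4`, `Quart.verFn4`, `Quart.accepts4 u y m`;
* `Quart.verFn4_mem_FP` and `Quart.verFn4_sq : verFn4 ⟨u, y⟩ = [accepts4 u y m]` (`|u| = m²`).

The semantic lemmas of the bricks file are private there, so their content is re-derived INSIDE the
two proofs below (as local `have`s; no restated declarations).
-/

set_option linter.dupNamespace false -- `Summit.PneNP.PneNP.…`: summit = sub-problem name (D-0017 single-conjunct layout)

namespace Summit.PneNP.PneNP.Theorems.NegLimitedDoor.Quart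

open _root_.Computability Polynomial
open Literature.Computability.Complexity Literature.Computability.Complexity.Brick
open Literature.Computability.Complexity.CliqueVerifier

/-- **Acceptance test** with clique size `⌊√⌊√m⌋⌋`: the first `m` bits of the certificate mark exactly
`⌊√⌊√m⌋⌋` vertices, every two of which are joined in the upper triangle of `u`. -/
def accepts4 (u y : List Bool) (m : ℕ) : Bool :=
  decide ((y.take m).count true = Nat.sqrt (Nat.sqrt m)) &&
    decide (∀ t, t < m * m → t / m < t % m → (y.take m).getD (t / m) false = true →
      (y.take m).getD (t % m) false = true → u.getD t false = true)

/-- Unfolding the acceptance test. -/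
theorem accepts4_eq_true_iff {u y : List Bool} {m : ℕ} :
    accepts4 u y m = true ↔ (y.take m).count true = Nat.sqrt (Nat.sqrt m) ∧
      ∀ t, t < m * m → t / m < t % m → (y.take m).getD (t / m) false = true →
        (y.take m).getD (t % m) false = true → u.getD t false = true := by
  simp only [accepts4, Bool.and_eq_true, decide_eq_true_iff]

noncomputable section

/-- The clique size `1ᵏ`, `k = ⌊√⌊√m⌋⌋` (one more integer square root on top of `CliqueVerifier.vK`). -/
def vK4 : List Bool → List Bool := binToUnaryFn ∘ fanoutFn vM (isqrtFn ∘ vK)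

/-- The count test `[#ones of y' = ⌊√⌊√m⌋⌋]`. -/
def cntOK4 : List Bool → List Bool := eqPairFn ∘ fanoutFn popFn vK4

/-- **The `⌊m^{1/4}⌋`-clique verifier**: quart count test and the (reused) edge test. -/
def verFn4 : List Bool → List Bool := andFn cntOK4 edgesOK

/-- **`verFn4 ∈ FP`** (compositions of the bricks; the FP facts of the reused public pieces are
re-derived locally). -/
theorem verFn4_mem_FP : verFn4 ∈ FP := by
  have vU_FP : vU ∈ FP := fstF_mem_FP
  have vY_FP : vY ∈ FP := sndF_mem_FP
  have vM_FP : vM ∈ FP :=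
    comp_mem_FP binToUnaryFn_mem_FP (fanoutFn_mem_FP vU_FP (comp_mem_FP isqrtFn_mem_FP vU_FP))
  have vK_FP : vK ∈ FP :=
    comp_mem_FP binToUnaryFn_mem_FP (fanoutFn_mem_FP vM_FP (comp_mem_FP isqrtFn_mem_FP vM_FP))
  have vK4_FP : vK4 ∈ FP :=
    comp_mem_FP binToUnaryFn_mem_FP (fanoutFn_mem_FP vM_FP (comp_mem_FP isqrtFn_mem_FP vK_FP))
  have vY'_FP : vY' ∈ FP := comp_mem_FP Plumb.takeFn_mem_FP (fanoutFn_mem_FP vM_FP vY_FP)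
  have bitTest_FP : ∀ {p s : List Bool → List Bool}, p ∈ FP → s ∈ FP → bitTest p s ∈ FP :=
    fun hp hs => comp_mem_FP eqPairFn_mem_FP
      (fanoutFn_mem_FP (comp_mem_FP bitAtFn_mem_FP (fanoutFn_mem_FP hp hs)) (const_mem_FP _))
  have popPiece_FP : popPiece ∈ FP :=
    iteFn_mem_FP (bitTest_FP sndF_mem_FP fstF_mem_FP) (const_mem_FP _) (const_mem_FP _)
  have popFn_FP : popFn ∈ FP :=
    comp_mem_FP (foldCat_mem_FP 1 X popPiece_FP) (fanoutFn_mem_FP vY'_FP vY'_FP)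
  have cntOK4_FP : cntOK4 ∈ FP := comp_mem_FP eqPairFn_mem_FP (fanoutFn_mem_FP popFn_FP vK4_FP)
  have rU_FP : rU ∈ FP := comp_mem_FP fstF_mem_FP fstF_mem_FP
  have rM_FP : rM ∈ FP := comp_mem_FP fstF_mem_FP (comp_mem_FP sndF_mem_FP fstF_mem_FP)
  have rY_FP : rY ∈ FP := comp_mem_FP sndF_mem_FP (comp_mem_FP sndF_mem_FP fstF_mem_FP)
  have rT_FP : rT ∈ FP := sndF_mem_FP
  have rAB_FP : rAB ∈ FP := comp_mem_FP Plumb.divModFn_mem_FP (fanoutFn_mem_FP rM_FP rT_FP)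
  have rA_FP : rA ∈ FP := comp_mem_FP fstF_mem_FP rAB_FP
  have rB_FP : rB ∈ FP := comp_mem_FP sndF_mem_FP rAB_FP
  have rViol_FP : rViol ∈ FP :=
    andFn_mem_FP (bitTest_FP rA_FP rB_FP) (andFn_mem_FP (bitTest_FP rA_FP rY_FP)
      (andFn_mem_FP (bitTest_FP rB_FP rY_FP) (notFn_mem_FP (bitTest_FP rT_FP rU_FP))))
  have violPiece_FP : violPiece ∈ FP := iteFn_mem_FP rViol_FP (const_mem_FP _) (const_mem_FP _)
  have violFn_FP : violFn ∈ FP :=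
    comp_mem_FP (foldCat_mem_FP 1 X violPiece_FP)
      (fanoutFn_mem_FP (fanoutFn_mem_FP vU_FP (fanoutFn_mem_FP vM_FP vY'_FP)) vU_FP)
  have edgesOK_FP : edgesOK ∈ FP :=
    comp_mem_FP eqPairFn_mem_FP (fanoutFn_mem_FP violFn_FP (const_mem_FP _))
  exact andFn_mem_FP cntOK4_FP edgesOK_FP

/-- The violation piece record (local copy of the bricks' private `rec`). -/
def qrec (u y' : List Bool) (m t : ℕ) : List Bool :=
  boolPair (boolPair u (boolPair (ones m) y')) (ones t)

/-- The violation test at position `t` (Boolean; local copy of the bricks' private `viol`). -/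
def qviol (u y' : List Bool) (m t : ℕ) : Bool :=
  decide (t / m < t % m) && (y'.getD (t / m) false && (y'.getD (t % m) false && !(u.getD t false)))

/-- **The `⌊m^{1/4}⌋`-clique verifier on a square matrix**: `verFn4 ⟨u, y⟩ = [accepts4 u y m]` for
`|u| = m²` (the semantics of the reused public pieces of the bricks file, re-derived locally). -/
theorem verFn4_sq {u y : List Bool} {m : ℕ} (hu : u.length = m * m) :
    verFn4 (boolPair u y) = [accepts4 u y m] := by
  -- one-bit tests
  have take_one_drop : ∀ (s : List Bool) (a : ℕ), (s.drop a).take 1 = [true] ↔ s.getD a false = true := by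
    intro s a
    by_cases h : a < s.length
    · rw [List.take_one_drop_eq_of_lt_length h, List.getD_eq_getElem _ _ h]
      simp
    · rw [List.drop_eq_nil_of_le (by omega), List.getD_eq_default _ _ (by omega)]
      simp
  have bitTest_apply : ∀ (p s : List Bool → List Bool) (z : List Bool),
      bitTest p s z = [(s z).getD (p z).length false] := by
    intro p s z
    simp only [bitTest, Function.comp_apply, fanoutFn_apply, bitAtFn_boolPair, eqPairFn_boolPair]
    congr 1
    rw [Bool.eq_iff_iff, decide_eq_true_iff, take_one_drop]
  have getD_ones : ∀ a b : ℕ, (ones b).getD a false = decide (a < b) := by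
    intro a b
    by_cases h : a < b
    · rw [List.getD_eq_getElem _ _ (by simpa [ones] using h)]
      simp [ones, h]
    · rw [List.getD_eq_default _ _ (by simpa [ones] using h)]
      simp [h]
  -- the side, the clique size, the truncated certificate
  have vM_sq : vM (boolPair u y) = ones m := by
    simp only [vM, vU, Function.comp_apply, fanoutFn_apply, fstF_boolPair, isqrtFn_apply,
      binToUnaryFn_boolPair, bitsToNat_encodeNat, hu, Nat.sqrt_eq, min_eq_left (Nat.le_mul_self m)]
  have vK_sq : vK (boolPair u y) = ones (Nat.sqrt m) := by
    simp only [vK, Function.comp_apply, fanoutFn_apply, vM_sq, isqrtFn_apply,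
      binToUnaryFn_boolPair, bitsToNat_encodeNat]
    simp [ones, min_eq_left (Nat.sqrt_le_self m)]
  have vK4_sq : vK4 (boolPair u y) = ones (Nat.sqrt (Nat.sqrt m)) := by
    simp only [vK4, Function.comp_apply, fanoutFn_apply, vM_sq, vK_sq, isqrtFn_apply,
      binToUnaryFn_boolPair, bitsToNat_encodeNat]
    simp [ones, min_eq_left ((Nat.sqrt_le_self _).trans (Nat.sqrt_le_self m))]
  have vY'_sq : vY' (boolPair u y) = y.take m := by
    simp only [vY', vY, Function.comp_apply, fanoutFn_apply, vM_sq, sndF_boolPair,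
      Plumb.takeFn_boolPair]
    simp [ones]
  -- the popcount fold
  have popPiece_apply : ∀ (y' : List Bool) (t : ℕ),
      popPiece (boolPair y' (ones t)) = if y'.getD t false = true then [true] else [] := by
    intro y' t
    have h := bitTest_apply sndF fstF (boolPair y' (ones t))
    simp only [sndF_boolPair, fstF_boolPair] at h
    rw [popPiece, iteFn_apply h]
    simp [ones]
  have ccat_pop : ∀ (l : List Bool),
      ccat (fun t => if l.getD t false = true then [true] else []) l.length = ones (l.count true) := by
    intro l
    induction l using List.reverseRecOn with
    | nil => simp [ones]
    | append_singleton l b ih =>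
      rw [List.length_append, List.length_singleton, ccat_succ]
      have h1 : ccat (fun t => if (l ++ [b]).getD t false = true then [true] else []) l.length =
          ccat (fun t => if l.getD t false = true then [true] else []) l.length :=
        ccat_congr fun t ht => by rw [List.getD_append _ _ _ _ ht]
      rw [h1, ih, List.getD_append_right _ _ _ _ le_rfl, Nat.sub_self, List.getD_cons_zero,
        List.count_append, List.count_singleton']
      cases b <;> simp [ones, List.replicate_add]
  have popFn_sq : popFn (boolPair u y) = ones ((y.take m).count true) := by
    rw [popFn, Function.comp_apply, fanoutFn_apply, vY'_sq, foldCat_apply]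
    · rw [← ccat_pop]
      exact ccat_congr fun t _ => popPiece_apply _ t
    · simp only [eval_X]; exact le_rfl
    · intro t _
      rw [popPiece_apply]
      split_ifs <;> simp
  have hiff : ones ((y.take m).count true) = ones (Nat.sqrt (Nat.sqrt m)) ↔
      (y.take m).count true = Nat.sqrt (Nat.sqrt m) :=
    ⟨fun h => by simpa [ones] using congrArg List.length h, fun h => by rw [h]⟩
  have cntOK4_sq : cntOK4 (boolPair u y) = [decide ((y.take m).count true = Nat.sqrt (Nat.sqrt m))] := by
    simp only [cntOK4, Function.comp_apply, fanoutFn_apply, popFn_sq, vK4_sq, eqPairFn_boolPair]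
    rw [decide_eq_decide.2 hiff]
  -- the violation fold (records)
  have rU_rec : ∀ (u' y' : List Bool) (m' t : ℕ), rU (qrec u' y' m' t) = u' := by
    intro u' y' m' t; simp only [rU, qrec, Function.comp_apply, fstF_boolPair]
  have rM_rec : ∀ (u' y' : List Bool) (m' t : ℕ), rM (qrec u' y' m' t) = ones m' := by
    intro u' y' m' t; simp only [rM, qrec, Function.comp_apply, fstF_boolPair, sndF_boolPair]
  have rY_rec : ∀ (u' y' : List Bool) (m' t : ℕ), rY (qrec u' y' m' t) = y' := by
    intro u' y' m' t; simp only [rY, qrec, Function.comp_apply, fstF_boolPair, sndF_boolPair]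
  have rT_rec : ∀ (u' y' : List Bool) (m' t : ℕ), rT (qrec u' y' m' t) = ones t := by
    intro u' y' m' t; simp only [rT, qrec, sndF_boolPair]
  have rAB_rec : ∀ (u' y' : List Bool) (m' t : ℕ), rAB (qrec u' y' m' t) = boolPair (ones (t / m')) (ones (t % m')) := by
    intro u' y' m' t
    simp only [rAB, Function.comp_apply, fanoutFn_apply, rM_rec, rT_rec]
    exact Plumb.divModFn_boolPair m' t
  have rA_rec : ∀ (u' y' : List Bool) (m' t : ℕ), rA (qrec u' y' m' t) = ones (t / m') := by
    intro u' y' m' t; simp only [rA, Function.comp_apply, rAB_rec, fstF_boolPair]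
  have rB_rec : ∀ (u' y' : List Bool) (m' t : ℕ), rB (qrec u' y' m' t) = ones (t % m') := by
    intro u' y' m' t; simp only [rB, Function.comp_apply, rAB_rec, sndF_boolPair]
  have rViol_rec : ∀ (u' y' : List Bool) (m' t : ℕ), rViol (qrec u' y' m' t) = [qviol u' y' m' t] := by
    intro u' y' m' t
    have hlt := bitTest_apply rA rB (qrec u' y' m' t)
    have hya := bitTest_apply rA rY (qrec u' y' m' t)
    have hyb := bitTest_apply rB rY (qrec u' y' m' t)
    have hut := bitTest_apply rT rU (qrec u' y' m' t)
    simp only [rA_rec, rB_rec, rY_rec, rT_rec, rU_rec, getD_ones] at hlt hya hyb hut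
    simp only [ones, List.length_replicate] at hlt hya hyb hut
    rw [rViol, andFn_apply hlt (andFn_apply hya (andFn_apply hyb (notFn_apply hut))), qviol]
  have violPiece_rec : ∀ (u' y' : List Bool) (m' t : ℕ), violPiece (qrec u' y' m' t) = if qviol u' y' m' t then [true] else [] := by
    intro u' y' m' t
    rw [violPiece, iteFn_apply (rViol_rec u' y' m' t)]
  have ccat_ite_nil : ∀ (P : ℕ → Prop) [DecidablePred P] (k : ℕ),
      ccat (fun t => if P t then [true] else []) k = [] ↔ ∀ t, t < k → ¬ P t := by
    intro P _ k
    induction k with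
    | zero => simp
    | succ k ih =>
      rw [ccat_succ, List.append_eq_nil_iff, ih]
      constructor
      · rintro ⟨h, h'⟩ t ht
        rcases Nat.lt_succ_iff_lt_or_eq.1 ht with ht | rfl
        · exact h t ht
        · intro hP; simp [hP] at h'
      · intro h
        exact ⟨fun t ht => h t (by omega), by simp [h k (by omega)]⟩
  have violFn_nil_iff : violFn (boolPair u y) = [] ↔ ∀ t, t < m * m → ¬ qviol u (y.take m) m t = true := by
    have hx : fanoutFn (fanoutFn vU (fanoutFn vM vY')) vU (boolPair u y) =
        boolPair (boolPair u (boolPair (ones m) (y.take m))) u := by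
      simp only [fanoutFn_apply, vU, fstF_boolPair, vM_sq, vY'_sq]
    rw [violFn, Function.comp_apply, hx, foldCat_apply, hu]
    · rw [← ccat_ite_nil (fun t => qviol u (y.take m) m t = true)]
      exact Iff.of_eq (congrArg (· = []) (ccat_congr fun t _ => by
        rw [show boolPair (boolPair u (boolPair (ones m) (y.take m))) (ones t) = qrec u (y.take m) m t
          from rfl, violPiece_rec]))
    · simp only [eval_X, length_boolPair]; omega
    · intro t _
      rw [show boolPair (boolPair u (boolPair (ones m) (y.take m))) (ones t) = qrec u (y.take m) m t
        from rfl, violPiece_rec]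
      split_ifs <;> simp
  have edgesOK_sq : edgesOK (boolPair u y) =
      [decide (∀ t, t < m * m → ¬ qviol u (y.take m) m t = true)] := by
    simp only [edgesOK, Function.comp_apply, fanoutFn_apply, eqPairFn_boolPair]
    rw [List.singleton_inj]
    exact decide_eq_decide.2 violFn_nil_iff
  -- assemble
  have hB : (∀ t, t < m * m → ¬ qviol u (y.take m) m t = true) ↔
      (∀ t, t < m * m → t / m < t % m → (y.take m).getD (t / m) false = true →
        (y.take m).getD (t % m) false = true → u.getD t false = true) := by
    refine forall_congr' fun t => forall_congr' fun ht => ?_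
    simp only [qviol, Bool.and_eq_true, decide_eq_true_iff, Bool.not_eq_true', not_and,
      Bool.not_eq_false]
  rw [verFn4, andFn_apply cntOK4_sq edgesOK_sq, accepts4, List.singleton_inj, decide_eq_decide.2 hB]

end

end Summit.PneNP.PneNP.Theorems.NegLimitedDoor.Quart
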